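import Literature.AlgebraicGeometry.Motives.ComplexPointsManifold
import Mathlib.SetTheory.Cardinal.Continuum
import Mathlib.Analysis.Real.Cardinality
import HarnessLib

/-!
# The complex points of a positive-dimensional smooth scheme are uncountable

Topic: `Literature/AlgebraicGeometry/Motives`. For a `ℂ`-scheme `X` smooth of relative dimension
`n ≥ 1` and locally of finite type, with at least one complex point, `X(ℂ)` is uncountable: an
algebraic chart at a complex point (`ComplexPoints.algebraicChart`, Serre GAGA §2 n°5) is a
homeomorphism of an open neighbourhood onto a non-empty open subset of `ℂⁿ`, which contains a real
segment. Used in countability ("Baire") arguments over curves: countably many proper closed subsets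
of a smooth curve do not exhaust its complex points.

## References

* J.-P. Serre, *Géométrie algébrique et géométrie analytique* (1956), §2 n°5 Prop. 2.
-/

noncomputable section

open CategoryTheory AlgebraicGeometry Set Metric

namespace Literature.AlgebraicGeometry.Motives

namespace ComplexPoints

variable (X : SchemeOver ℂ) (n : ℕ) [SmoothOfRelativeDimension n X.hom] [LocallyOfFiniteType X.hom]

/-- A real open interval is not countable (it has the cardinality of the continuum). [folklore] -/
theorem not_countable_Ioo_real {a b : ℝ} (h : a < b) : ¬ Countable (Ioo a b) := by
  intro hc
  have h1 : Cardinal.mk (Ioo a b) ≤ Cardinal.aleph0 := Cardinal.mk_le_aleph0_iff.2 hc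
  rw [Cardinal.mk_Ioo_real h] at h1
  exact (Cardinal.aleph0_lt_continuum.trans_le h1).false

/-- **`X(ℂ)` is uncountable** for `X` smooth of relative dimension `n ≥ 1` and locally of finite
type over `ℂ` with a complex point `P`: the algebraic chart at `P` (Serre, GAGA §2 n°5 Prop. 2, the
tree's `ComplexPoints.algebraicChart`) identifies an open neighbourhood of `P` with a non-empty open
subset of `ℂⁿ`, which contains a real segment `s ↦ c + s • e₁`, `|s| < ε`.
[cite: SerreGAGA1956, §2 n°5 Prop. 2] -/
theorem not_countable_of_smoothOfRelativeDimension (hn : 0 < n) (P : ComplexPoints X) :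
    ¬ Countable (ComplexPoints X) := by
  intro hX
  set e := algebraicChart X n P with he
  have hP : P ∈ e.source := mem_algebraicChart_source X n P
  set c : Fin n → ℂ := e P with hc
  have hct : c ∈ e.target := e.map_source hP
  obtain ⟨ε, hε, hball⟩ := Metric.isOpen_iff.1 e.open_target c hct
  -- the segment `s ↦ c + s • e₁` inside the ball
  set v : Fin n → ℂ := Pi.single ⟨0, hn⟩ 1 with hv
  have hvnorm : ‖v‖ = 1 := by
    rw [hv, Pi.norm_single, norm_one]
  have hv0 : v ≠ 0 := fun h0 => by
    rw [h0, norm_zero] at hvnorm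
    exact zero_ne_one hvnorm
  let γ : Ioo (-ε) ε → ComplexPoints X := fun s => e.symm (c + ((s : ℝ) : ℂ) • v)
  have hγmem : ∀ s : Ioo (-ε) ε, c + ((s : ℝ) : ℂ) • v ∈ e.target := fun s => by
    apply hball
    rw [Metric.mem_ball, dist_eq_norm, add_sub_cancel_left, norm_smul, hvnorm, mul_one,
      Complex.norm_real, Real.norm_eq_abs, abs_lt]
    exact ⟨s.2.1, s.2.2⟩
  have hγ : Function.Injective γ := by
    intro s s' hss'
    have h1 : c + ((s : ℝ) : ℂ) • v = c + ((s' : ℝ) : ℂ) • v :=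
      e.symm.injOn (by rw [e.symm_source]; exact hγmem s) (by rw [e.symm_source]; exact hγmem s')
        hss'
    have h2 : ((s : ℝ) : ℂ) • v = ((s' : ℝ) : ℂ) • v := add_left_cancel h1
    have h3 : ((s : ℝ) : ℂ) = ((s' : ℝ) : ℂ) := smul_left_injective ℂ hv0 h2
    exact Subtype.ext (Complex.ofReal_injective h3)
  haveI : Countable (Ioo (-ε) ε) := hγ.countable
  exact not_countable_Ioo_real (by linarith) this

end ComplexPoints

end Literature.AlgebraicGeometry.Motives

end
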